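import Literature.NumberTheory.Automorphic.AdelicUnitaryGroupDatum      -- ★ `UnitaryGroup.cmDatum`, `«local»`, `conjLocal`, `adelicForm`, `adeleToLocal`, `LocalRing`
import Literature.NumberTheory.Automorphic.UnitaryGroupLocalFactors      -- ★ `continuous_conjLocal`, `isClosed_local`
import Mathlib.MeasureTheory.Integral.Bochner.Basic
import HarnessLib

/-!
# K2 ∕ E3 «EllipticInputs», U12 rows 11∕12 — DEFS LEAF `K2E3LieUnitaryDefs`: the LIE ALGEBRA `𝔲(σ, J) = {X | ᵗ(σX)·J + J·X = 0}` of a unitary group,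
# its `Ad`-invariance, and the Fourier transform on it (objects (O1), (O4) of K2E3-p12's SPEC «LieCore-U12»)

Cell `hodgecm-mathlib` (Track B «K2-LIT»), item h413 = `stmt-HodgeConjecture-24833`, line `K2_E3_EllipticInputs`, sockets U12 rows 11∕12 ((11-Id), (12-Id) ⟺
(12-Lie), (11-D), (12-D)) and 9L; author K2-defs1 (g2) (Track B defs pen) on K2E3-p12 (g2)'s CUT REQUEST `K2/K2E3-p12/g2/SPEC-LieCore-U12.v1.K2E3-p12-g2.md`
(sha16 9c00630b722b637b) §1 (O1), (O4) + §3; count-neutral; `--supports … --as helper`.  DEFINITIONS WITH BODIES + `rfl`∕closure lemmas + ONE structure theorem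
(`Ad(g)` preserves `𝔲`); no `sorry`, no named fact, no `instance`, no `notation`; NO `L⁺_v`-module structure is used anywhere (SPEC §1: `𝔲` is an ADDITIVE
SUBGROUP, a module over the `σ`-fixed scalars by `smul_mem_lieOfForm`).

* §1 GENERIC (`R` a commutative ring, `σ : R →+* R`, `J ∈ M_n(R)`): **`lieOfForm σ J : AddSubgroup (Matrix n n R)`** `= {X | (X.map σ)ᵀ * J + J * X = 0}`
  (`mem_lieOfForm_iff` rfl; **`mem_lieOfForm_iff'`**: `↔ (X.map σ)ᵀ * J = -(J * X)`, VERBATIM the skew condition inlined in the U12 sockets), `smul_mem_lieOfForm`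
  (`σ a = a ⇒ a • X ∈ 𝔲`), `isClosed_lieOfForm` (topological ring, `T₂`, `σ` continuous), **`conj_mem_lieOfForm`**: `g ∈ U(σ, J) = unitaryGroupOfForm σ J`, `X ∈ 𝔲`
  `⇒ g X g⁻¹ ∈ 𝔲` (the adjoint action; NO invertibility of `J` needed: from `ᵗ(σg) J g = J` one gets `ᵗ(σg) J = J g⁻¹` and `ᵗ(σg⁻¹) J = J g`), and the
  **Fourier transform** `lieFourier σ J ψ μ f Y := ∫ X, ψ (trace (Y·X)) * f X ∂μ` for a function `ψ : R → ℂ` (an additive character, SPEC (O3) — binder), a measure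
  `μ` on `↥(lieOfForm σ J)` (Haar, SPEC (O2) — binder) and `f : ↥𝔲 → ℂ` [HC1999 p. 11: `f̂(Y) = ∫ χ(B(Y, X)) f(X) dX`, `B(X, Y) = tr(XY)`].
* §2 CM DRESS at a finite place `v` of `L⁺` (the U12 sockets' currency VERBATIM: `R = UnitaryGroup.LocalRing L v = ∏_{w ∣ v} L_w`, `σ = UnitaryGroup.conjLocal L c v`,
  `J_v = (UnitaryGroup.adelicForm L N H).map (UnitaryGroup.adeleToLocal L v)`): **`lieU L N H v`** `:= lieOfForm σ_v J_v` (SPEC (O1)), `mem_lieU_iff` (socket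
  phrasing), `isClosed_lieU`, **`conj_mem_lieU (g : (UnitaryGroup.cmDatum L N H).Local v)`** (`Ad`-invariance under `U_N(H)(L⁺_v)`), `lieUFourier` (SPEC (O4)).

Not here (SPEC: binders∕hypotheses, not defs): Haar measure on `↥𝔲` (O2), the character `ψ` (O3), the distributions `J(𝒩)` (O5), regularity (O6).  Coordination
(SPEC §3): K2E1b-p08's `U`-transport files use `{X | θ′ X = X}`; a bridge lemma to `lieU` is one line once that carrier's FQN is posted.

HONEST LABEL: HC_CM is proved only modulo the 7 printed citations (2 remaining named inputs: hLiu418 = stmt-HodgeConjecture-24832, h413 =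
stmt-HodgeConjecture-24833) until rung 0 closes; this file is count-neutral (definitions only).

## References
* [HarishChandra1999] Harish-Chandra (notes by S. DeBacker, P. J. Sally, Jr.), *Admissible Invariant Distributions on Reductive p-adic Groups*, ULECT 16 (1999),
  §4 p. 11 (`𝔤`, `B(X, Y)`, `f̂(Y) = ∫ χ(B(Y,X)) f(X) dX`, distributions `J(ω)`).
* [PlatonovRapinchuk1994] V. Platonov, A. Rapinchuk, *Algebraic Groups and Number Theory* (1994), §2.3 (unitary groups of hermitian forms and their Lie algebras).
* [Knapp2002] A. W. Knapp, *Lie Groups Beyond an Introduction*, 2nd ed. (2002), I §1 (`𝔲 = {X | X* J + J X = 0}`, `Ad(g)X = gXg⁻¹`).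
-/

set_option autoImplicit false
-- the mandated namespace repeats `HodgeConjecture.HodgeConjecture`, as in every `Theorems/*.lean` of this sub-problem
set_option linter.dupNamespace false

namespace Summit.HodgeConjecture.HodgeConjecture.Cruxes.H413.K2E3LieUnitary

open MeasureTheory NumberField IsDedekindDomain
open Literature.NumberTheory.Automorphic
open scoped Matrix MatrixGroups

/-! ## §1 The Lie algebra of `U(σ, J)` over a commutative ring with an endomorphism -/

section Generic

variable {R : Type*} [CommRing R] (σ : R →+* R) {n : Type*} [Fintype n] [DecidableEq n] (J : Matrix n n R)

/-- **The Lie algebra `𝔲(σ, J) = {X ∈ M_n(R) | ᵗ(σX)·J + J·X = 0}` of the unitary group `U(σ, J)(R)`**, as an additive subgroup of `M_n(R)` (the derivative at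
`1` of `ᵗ(σg) J g = J`). [cite: Knapp2002, I §1] [cite: PlatonovRapinchuk1994, §2.3] -/
def lieOfForm : AddSubgroup (Matrix n n R) where
  carrier := {X | (X.map σ)ᵀ * J + J * X = 0}
  zero_mem' := by simp [Matrix.map_zero σ (map_zero σ)]
  add_mem' {X Y} hX hY := by
    simp only [Set.mem_setOf_eq] at hX hY ⊢
    rw [Matrix.map_add σ (map_add σ), Matrix.transpose_add, add_mul, mul_add, add_add_add_comm, hX, hY, add_zero]
  neg_mem' {X} hX := by
    simp only [Set.mem_setOf_eq] at hX ⊢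
    rw [Matrix.map_neg σ (map_neg σ), Matrix.transpose_neg, neg_mul, mul_neg, ← neg_add, hX, neg_zero]

variable {σ J}

/-- Membership in `𝔲(σ, J)`: `ᵗ(σX)·J + J·X = 0` (`rfl`). [cite: Knapp2002, I §1] -/
theorem mem_lieOfForm_iff (X : Matrix n n R) : X ∈ lieOfForm σ J ↔ (X.map σ)ᵀ * J + J * X = 0 := Iff.rfl

/-- Membership in `𝔲(σ, J)`, skew phrasing `ᵗ(σX)·J = −J·X` — VERBATIM the condition inlined in the U12 sockets. [cite: Knapp2002, I §1] -/
theorem mem_lieOfForm_iff' (X : Matrix n n R) : X ∈ lieOfForm σ J ↔ (X.map σ)ᵀ * J = -(J * X) := by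
  rw [mem_lieOfForm_iff, add_eq_zero_iff_eq_neg]

/-- `𝔲(σ, J)` is a module over the `σ`-FIXED scalars: `σ a = a`, `X ∈ 𝔲 ⇒ a • X ∈ 𝔲` (no module structure over a subfield is introduced).
[cite: PlatonovRapinchuk1994, §2.3] -/
theorem smul_mem_lieOfForm {a : R} (ha : σ a = a) {X : Matrix n n R} (hX : X ∈ lieOfForm σ J) : a • X ∈ lieOfForm σ J := by
  rw [mem_lieOfForm_iff] at hX ⊢
  have hmap : (a • X).map σ = a • X.map σ := by
    ext i j
    simp [ha]
  rw [hmap, Matrix.transpose_smul, smul_mul_assoc, mul_smul_comm, ← smul_add, hX, smul_zero]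

/-- `𝔲(σ, J)` is CLOSED in `M_n(R)` for a `T₂` topological ring `R` and continuous `σ` (a level set of a continuous map). [cite: PlatonovRapinchuk1994, §2.3] -/
theorem isClosed_lieOfForm [TopologicalSpace R] [IsTopologicalRing R] [T2Space R] (hσ : Continuous σ) :
    IsClosed (lieOfForm σ J : Set (Matrix n n R)) := by
  have hc : Continuous fun X : Matrix n n R => (X.map σ)ᵀ * J + J * X :=
    ((continuous_id.matrix_map hσ).matrix_transpose.mul continuous_const).add (continuous_const.mul continuous_id)
  exact isClosed_eq hc continuous_const

/-- **`Ad`-INVARIANCE: `g ∈ U(σ, J)`, `X ∈ 𝔲(σ, J)` ⇒ `g·X·g⁻¹ ∈ 𝔲(σ, J)`.**  From `ᵗ(σg)·J·g = J`: `ᵗ(σg)·J = J·g⁻¹` and `ᵗ(σg⁻¹)·J = J·g` (no invertibility of `J`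
is used), so `ᵗ(σ(gXg⁻¹))·J = ᵗ(σg⁻¹)·ᵗ(σX)·ᵗ(σg)·J = ᵗ(σg⁻¹)·ᵗ(σX)·J·g⁻¹ = −ᵗ(σg⁻¹)·J·X·g⁻¹ = −J·g·X·g⁻¹`. [cite: Knapp2002, I §1] -/
theorem conj_mem_lieOfForm {g : GL n R} (hg : g ∈ unitaryGroupOfForm σ J) {X : Matrix n n R} (hX : X ∈ lieOfForm σ J) :
    (g : Matrix n n R) * X * ((g⁻¹ : GL n R) : Matrix n n R) ∈ lieOfForm σ J := by
  rw [mem_unitaryGroupOfForm_iff] at hg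
  rw [mem_lieOfForm_iff'] at hX
  rw [mem_lieOfForm_iff]
  set A : Matrix n n R := ((g : Matrix n n R).map σ)ᵀ with hA
  set B : Matrix n n R := (((g⁻¹ : GL n R) : Matrix n n R).map σ)ᵀ with hB
  -- `B * A = 1`
  have hBA : B * A = 1 := by
    rw [hA, hB, ← Matrix.transpose_mul, ← Matrix.map_mul, ← Units.val_mul, mul_inv_cancel, Units.val_one,
      Matrix.map_one σ (map_zero σ) (map_one σ), Matrix.transpose_one]
  -- `A * J = J * g⁻¹` and `B * J = J * g`
  have hAJ : A * J = J * ((g⁻¹ : GL n R) : Matrix n n R) := by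
    calc A * J = A * J * ((g : Matrix n n R) * ((g⁻¹ : GL n R) : Matrix n n R)) := by
          rw [← Units.val_mul, mul_inv_cancel, Units.val_one, Matrix.mul_one]
      _ = (A * J * (g : Matrix n n R)) * ((g⁻¹ : GL n R) : Matrix n n R) := by simp only [Matrix.mul_assoc]
      _ = J * ((g⁻¹ : GL n R) : Matrix n n R) := by rw [hg]
  have hBJ : B * J = J * (g : Matrix n n R) := by
    calc B * J = B * (A * J * (g : Matrix n n R)) := by rw [hg]
      _ = (B * A) * J * (g : Matrix n n R) := by simp only [Matrix.mul_assoc]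
      _ = J * (g : Matrix n n R) := by rw [hBA, Matrix.one_mul]
  -- the transpose-conjugate of `g X g⁻¹`
  have hT : (((g : Matrix n n R) * X * ((g⁻¹ : GL n R) : Matrix n n R)).map σ)ᵀ = B * (X.map σ)ᵀ * A := by
    rw [Matrix.map_mul, Matrix.map_mul, Matrix.transpose_mul, Matrix.transpose_mul, hA, hB, Matrix.mul_assoc]
  have h1 : B * (X.map σ)ᵀ * A * J = -(J * (g : Matrix n n R) * X * ((g⁻¹ : GL n R) : Matrix n n R)) := by
    calc B * (X.map σ)ᵀ * A * J = B * ((X.map σ)ᵀ * (A * J)) := by simp only [Matrix.mul_assoc]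
      _ = B * ((X.map σ)ᵀ * J * ((g⁻¹ : GL n R) : Matrix n n R)) := by rw [hAJ]; simp only [Matrix.mul_assoc]
      _ = B * (-(J * X) * ((g⁻¹ : GL n R) : Matrix n n R)) := by rw [hX]
      _ = -(B * J * X * ((g⁻¹ : GL n R) : Matrix n n R)) := by simp only [Matrix.neg_mul, Matrix.mul_neg, Matrix.mul_assoc]
      _ = -(J * (g : Matrix n n R) * X * ((g⁻¹ : GL n R) : Matrix n n R)) := by rw [hBJ]
  rw [hT, h1]
  simp only [Matrix.mul_assoc]
  exact neg_add_cancel _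

variable (σ J)

/-- **The Fourier transform on `𝔲(σ, J)`**: `𝓕 f (Y) = ∫ ψ(tr(Y·X)) · f(X) dμ(X)` for a function `ψ : R → ℂ` (an additive character — binder (O3)) and a measure
`μ` on `↥𝔲` (Haar — binder (O2)); the pairing `B(X, Y) = tr(XY)` is `σ`-invariant on `𝔲`, so `ψ ∘ B` only sees the fixed part. [cite: HarishChandra1999, §4 p. 11] -/
noncomputable def lieFourier [MeasurableSpace ↥(lieOfForm σ J)] (ψ : R → ℂ) (μ : Measure ↥(lieOfForm σ J)) (f : ↥(lieOfForm σ J) → ℂ)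
    (Y : ↥(lieOfForm σ J)) : ℂ :=
  ∫ X, ψ (Matrix.trace (Y.1 * X.1)) * f X ∂μ

/-- Unfolding of `lieFourier` (`rfl`). [cite: HarishChandra1999, §4 p. 11] -/
theorem lieFourier_apply [MeasurableSpace ↥(lieOfForm σ J)] (ψ : R → ℂ) (μ : Measure ↥(lieOfForm σ J)) (f : ↥(lieOfForm σ J) → ℂ)
    (Y : ↥(lieOfForm σ J)) : lieFourier σ J ψ μ f Y = ∫ X, ψ (Matrix.trace (Y.1 * X.1)) * f X ∂μ := rfl

end Generic

/-! ## §2 CM dress at a finite place: `𝔲_N(H)(L⁺_v)` in the currency of the U12 sockets -/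

section CM

variable (L : Type) [Field L] [NumberField L] [IsCMField L] (N : ℕ) (H : Matrix (Fin N) (Fin N) L)
  (v : HeightOneSpectrum (𝓞 ↥(maximalRealSubfield L)))

/-- **`𝔲_N(H)(L⁺_v)`** = SPEC (O1): the Lie algebra of `U_N(H)(L⁺_v) = (UnitaryGroup.cmDatum L N H).Local v`, i.e. `lieOfForm` for
`σ_v = UnitaryGroup.conjLocal L c v` and `J_v = (UnitaryGroup.adelicForm L N H).map (UnitaryGroup.adeleToLocal L v)` on `M_N(∏_{w∣v} L_w)`.
[cite: HarishChandra1999, §4 p. 11] [cite: PlatonovRapinchuk1994, §2.3] -/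
noncomputable def lieU : AddSubgroup (Matrix (Fin N) (Fin N) (UnitaryGroup.LocalRing L v)) :=
  lieOfForm (UnitaryGroup.conjLocal L (IsCMField.complexConj L) v) ((UnitaryGroup.adelicForm L N H).map (UnitaryGroup.adeleToLocal L v))

variable {L N H v}

/-- Membership in `𝔲_N(H)(L⁺_v)`, in the U12 sockets' phrasing: `(X.map σ_v)ᵀ * J_v = -(J_v * X)`. [cite: HarishChandra1999, §4 p. 11] -/
theorem mem_lieU_iff (X : Matrix (Fin N) (Fin N) (UnitaryGroup.LocalRing L v)) :
    X ∈ lieU L N H v ↔ (X.map (UnitaryGroup.conjLocal L (IsCMField.complexConj L) v))ᵀ * ((UnitaryGroup.adelicForm L N H).map (UnitaryGroup.adeleToLocal L v)) =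
      -(((UnitaryGroup.adelicForm L N H).map (UnitaryGroup.adeleToLocal L v)) * X) :=
  mem_lieOfForm_iff' X

/-- `lieU L N H v = lieOfForm σ_v J_v` (`rfl`). [cite: PlatonovRapinchuk1994, §2.3] -/
theorem lieU_eq : lieU L N H v =
    lieOfForm (UnitaryGroup.conjLocal L (IsCMField.complexConj L) v) ((UnitaryGroup.adelicForm L N H).map (UnitaryGroup.adeleToLocal L v)) := rfl

/-- `𝔲_N(H)(L⁺_v)` is closed in `M_N(∏_{w∣v} L_w)` (★ `continuous_conjLocal`). [cite: PlatonovRapinchuk1994, §2.3] -/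
theorem isClosed_lieU : IsClosed (lieU L N H v : Set (Matrix (Fin N) (Fin N) (UnitaryGroup.LocalRing L v))) :=
  isClosed_lieOfForm (UnitaryGroup.continuous_conjLocal L (IsCMField.complexConj L) v)

/-- **`Ad(g)` preserves `𝔲_N(H)(L⁺_v)`** for `g ∈ U_N(H)(L⁺_v) = (UnitaryGroup.cmDatum L N H).Local v`: `g·X·g⁻¹ ∈ 𝔲`. [cite: Knapp2002, I §1] -/
theorem conj_mem_lieU (g : (UnitaryGroup.cmDatum L N H).Local v) {X : Matrix (Fin N) (Fin N) (UnitaryGroup.LocalRing L v)} (hX : X ∈ lieU L N H v) :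
    ((g.1 : GL (Fin N) (UnitaryGroup.LocalRing L v)) : Matrix (Fin N) (Fin N) (UnitaryGroup.LocalRing L v)) * X *
      (((g.1)⁻¹ : GL (Fin N) (UnitaryGroup.LocalRing L v)) : Matrix (Fin N) (Fin N) (UnitaryGroup.LocalRing L v)) ∈ lieU L N H v :=
  conj_mem_lieOfForm g.2 hX

variable (L N H v)

/-- **The Fourier transform on `𝔲_N(H)(L⁺_v)`** = SPEC (O4): `𝓕 f (Y) = ∫ X, ψ (trace (Y·X)) * f X ∂μ𝔤` (`ψ`, `μ𝔤` binders). [cite: HarishChandra1999, §4 p. 11] -/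
noncomputable def lieUFourier [MeasurableSpace ↥(lieU L N H v)] (ψ : UnitaryGroup.LocalRing L v → ℂ) (μ : Measure ↥(lieU L N H v))
    (f : ↥(lieU L N H v) → ℂ) (Y : ↥(lieU L N H v)) : ℂ :=
  ∫ X, ψ (Matrix.trace (Y.1 * X.1)) * f X ∂μ

/-- Unfolding of `lieUFourier` (`rfl`). [cite: HarishChandra1999, §4 p. 11] -/
theorem lieUFourier_apply [MeasurableSpace ↥(lieU L N H v)] (ψ : UnitaryGroup.LocalRing L v → ℂ) (μ : Measure ↥(lieU L N H v))
    (f : ↥(lieU L N H v) → ℂ) (Y : ↥(lieU L N H v)) : lieUFourier L N H v ψ μ f Y = ∫ X, ψ (Matrix.trace (Y.1 * X.1)) * f X ∂μ := rfl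

end CM

end Summit.HodgeConjecture.HodgeConjecture.Cruxes.H413.K2E3LieUnitary
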